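/-
Copyright (c) 2026.  Released under the Apache 2.0 license of this project.
Cell decomp-a2c, lens 4 (minimal-counterexample / extremal reduction), generation 68.
-/
import Mathlib

/-!
(SPLIT FOR THE 400-LINE CAP by the landing lane, hand-2 g33: this file = part 1 of 2; sequels `…OverbindingBudgetAffineRadialReduction` import it in a chain; same namespace, all FQNs unchanged.)
# Radial (extremal) reduction of the far-core certificate table (slot Z, leaf Z2)

The hypothesis `hcert` of the landed theorem
`OverbindingBudgetAffineFarSmoothSplit.farCoreExcess_of_hcpEnclosures` asks, for every admissible far
window `(w, X)`, for the value inequality `T₃↑(w,X)² · L6hi ≤ (l3² − 24κ″·L6hi) · T₆↓(w,X)`; on the pinned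
Gram chart of a structure class this is `b ≤ ψ x` for the scale-free functional `ψ = T₆↓ / T₃↑²`
(`b = L6hi / (l3² − 24κ″·L6hi)`), to be certified for all chart points `x ∈ K` outside the small ball
`‖x − x₀‖ < r₁` around the class centre `x₀` (the perfect `hcp`-type Gram point), which the far clause
excludes.  The generation-59…67 design certifies the VALUE `ψ x ≥ b` cell by cell; because `ψ − b`
vanishes to second order at `x₀`, value cells have half-width `≈ |x − x₀| / 5` and the campaign costs
`≈ 1.6·10⁴` cells per class (g67 memo §0) — the slot-Z blocker.

This file proves the EXTREMAL REDUCTION behind an alternative table.  Along the ray `t ↦ x₀ + t·u`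
(`‖u‖ = 1`) put `φ(t) = ψ(x₀ + t·u)`.  If a counterexample `ψ x < b` existed at radius `‖x − x₀‖ ≥ r₁`, then
on the ray through `x` there would be a point that is RADIALLY CRITICAL AND RADIALLY NON-CONVEX
(`φ' ≤ 0` and `φ'' ≤ 0`) outside the core ball, or the strong radial convexity near the centre would fail.
Hence the value table is implied by

* (C) strong radial convexity near the centre: `φ'' ≥ m₀ > 0` for `t ∈ [0, ρ]` (all directions);
* (B) the disjunction table: `0 < φ'(t) ∨ 0 < φ''(t)` for `t ∈ [ρ, ‖x − x₀‖]`, i.e. at every chart point `y`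
  with `ρ ≤ ‖y − x₀‖` the radial slope or the radial curvature of `ψ` is positive;
* (G) centre data: `|φ'(0)| ≤ η` (the centre need not be exactly critical), `φ(0) ≥ b − δ₀`;
* the numeric side conditions `δ₀ + η t ≤ ½ m₀ t²` on `[r₁, ρ]` and `η < m₀ ρ`

(`ray_bound`, §1), assembled over a star-convex chart region in `radial_reduction` (§2) and, with an outer
collar certified by value rows, in `radial_reduction_collar` (§3).  Both derivative conditions are
RELATIVE-ERROR statements (`φ''` is of order one where it is the active disjunct, `φ'` grows linearly), so
their cells do not shrink towards the centre; the zone-I/zone-II bookkeeping and the quadratic-model FACT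
of the census design are replaced by (C) and the explicit radius `r₁`.

All statements are over `Mathlib` only (pure one-variable calculus + a star-convexity assembly); the
instantiation (`E = ` the five pinned Gram coordinates, `ψ₁`, `ψ₂` = the explicit weighted inverse-power
family sums that are the radial derivatives of `ψ`) is described in §4 and is the job of the kernel file.
No `sorry`, no new axioms.
-/

open Set Filter Topology

namespace Summit.AtomisticToContinuum.Crystallization.Theorems.OverbindingBudgetAffineRadialReduction

/-! ## §1 One-dimensional lemmas along a ray -/

/-- A function with positive derivative at `x` takes a strictly smaller value somewhere in every left
neighbourhood `(a, x)`. -/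
theorem exists_lt_of_hasDerivAt_pos {g : ℝ → ℝ} {g' x a : ℝ} (h : HasDerivAt g g' x)
    (hg' : 0 < g') (ha : a < x) : ∃ s ∈ Ioo a x, g s < g x := by
  have hT := h.tendsto_slope_zero_left
  have ev1 : ∀ᶠ t in 𝓝[<] (0 : ℝ), 0 < t⁻¹ • (g (x + t) - g x) := hT.eventually (lt_mem_nhds hg')
  have ev2 : ∀ᶠ t in 𝓝[<] (0 : ℝ), t ∈ Ioo (a - x) 0 := Ioo_mem_nhdsLT (by linarith)
  obtain ⟨t, ht1, ht2⟩ := (ev1.and ev2).exists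
  refine ⟨x + t, ⟨by linarith [ht2.1], by linarith [ht2.2]⟩, ?_⟩
  rw [smul_eq_mul] at ht1
  have hne : t ≠ 0 := ht2.2.ne
  have hprod : t * (t⁻¹ * (g (x + t) - g x)) < 0 := mul_neg_of_neg_of_pos ht2.2 ht1
  have hid : t * (t⁻¹ * (g (x + t) - g x)) = g (x + t) - g x := by
    field_simp
  linarith

/-- THE UP-SET LEMMA.  If `φ'` is differentiable on `[a, b]` with derivative `φ''`, if at every point
`0 < φ'` or `0 < φ''` (no radially-critical non-convex point), and if `0 ≤ φ' a`, then `0 < φ'` on `(a, b]`. -/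
theorem deriv_pos_of_disj {φ' φ'' : ℝ → ℝ} {a b : ℝ}
    (hd : ∀ t ∈ Icc a b, HasDerivAt φ' (φ'' t) t)
    (hdisj : ∀ t ∈ Icc a b, 0 < φ' t ∨ 0 < φ'' t) (ha : 0 ≤ φ' a) :
    ∀ t ∈ Ioc a b, 0 < φ' t := by
  intro t ht
  by_contra hle
  push Not at hle
  have hat : a ≤ t := ht.1.le
  have hsub : Icc a t ⊆ Icc a b := Icc_subset_Icc_right ht.2
  have hcont : ContinuousOn φ' (Icc a t) := fun s hs =>
    (hd s (hsub hs)).continuousAt.continuousWithinAt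
  obtain ⟨c, hc, hmin⟩ := isCompact_Icc.exists_isMinOn (nonempty_Icc.2 hat) hcont
  have hmin' : ∀ s ∈ Icc a t, φ' c ≤ φ' s := isMinOn_iff.1 hmin
  by_cases hlt : φ' c < φ' t
  · -- `c` is an interior minimiser of `φ'`: Fermat gives `φ'' c = 0`, but `φ' c < 0` forces `φ'' c > 0`.
    have hca : c ≠ a := by
      intro h
      rw [h] at hlt
      linarith
    have hct : c ≠ t := by
      intro h
      rw [h] at hlt
      exact lt_irrefl _ hlt
    have hc' : c ∈ Ioo a t := ⟨lt_of_le_of_ne hc.1 (Ne.symm hca), lt_of_le_of_ne hc.2 hct⟩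
    have hloc : IsLocalMin φ' c := hmin.isLocalMin (Icc_mem_nhds hc'.1 hc'.2)
    have h0 : φ'' c = 0 := hloc.hasDerivAt_eq_zero (hd c (hsub hc))
    have hneg : φ' c < 0 := lt_of_lt_of_le hlt hle
    rcases hdisj c (hsub hc) with h | h
    · linarith
    · linarith
  · -- `t` itself minimises `φ'` on `[a, t]` and `φ' t ≤ 0`, so `φ'' t > 0`: contradiction with the left slope.
    push Not at hlt
    have hmin_t : ∀ s ∈ Icc a t, φ' t ≤ φ' s := fun s hs => hlt.trans (hmin' s hs)
    have htI : t ∈ Icc a b := hsub (right_mem_Icc.2 hat)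
    have hpos : 0 < φ'' t := by
      rcases hdisj t htI with h | h
      · linarith
      · exact h
    obtain ⟨s, hs, hlt'⟩ := exists_lt_of_hasDerivAt_pos (hd t htI) hpos ht.1
    linarith [hmin_t s ⟨hs.1.le, hs.2.le⟩]

/-- INNER BOUND (strong radial convexity near the centre).  On `[0, ρ]`: if `φ'' ≥ m₀`, `φ' 0 ≥ −η` and
`φ 0 ≥ b − δ₀`, then `φ' t ≥ −η + m₀ t` and `φ t ≥ φ 0 − η t + ½ m₀ t²`; in particular `φ t ≥ b` wherever
`δ₀ + η t ≤ ½ m₀ t²`. -/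
theorem inner_bound {φ φ' φ'' : ℝ → ℝ} {ρ m₀ η δ₀ b r₁ : ℝ}
    (hd1 : ∀ t ∈ Icc 0 ρ, HasDerivAt φ (φ' t) t) (hd2 : ∀ t ∈ Icc 0 ρ, HasDerivAt φ' (φ'' t) t)
    (hconv : ∀ t ∈ Icc 0 ρ, m₀ ≤ φ'' t) (hη : -η ≤ φ' 0) (h0 : b - δ₀ ≤ φ 0)
    (hq : ∀ t ∈ Icc r₁ ρ, δ₀ + η * t ≤ m₀ / 2 * t ^ 2) (hr₁ : 0 ≤ r₁) :
    (∀ t ∈ Icc 0 ρ, -η + m₀ * t ≤ φ' t) ∧ (∀ t ∈ Icc r₁ ρ, b ≤ φ t) := by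
  -- (i) slope growth: `s ↦ φ' s − s·m₀` is monotone on `[0, ρ]`.
  have hslope : ∀ t ∈ Icc 0 ρ, -η + m₀ * t ≤ φ' t := by
    intro t ht
    have hρ : (0 : ℝ) ≤ ρ := ht.1.trans ht.2
    have hder : ∀ s ∈ Icc 0 ρ, HasDerivAt (fun s => φ' s - s * m₀) (φ'' s - m₀) s := fun s hs =>
      (hd2 s hs).sub (hasDerivAt_mul_const m₀)
    have hmono : MonotoneOn (fun s => φ' s - s * m₀) (Icc 0 ρ) :=
      monotoneOn_of_hasDerivWithinAt_nonneg (convex_Icc 0 ρ)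
        (fun s hs => (hder s hs).continuousAt.continuousWithinAt)
        (fun s hs => (hder s (interior_subset hs)).hasDerivWithinAt)
        (fun s hs => by linarith [hconv s (interior_subset hs)])
    have := hmono (left_mem_Icc.2 hρ) ht ht.1
    simp only [zero_mul, sub_zero] at this
    linarith
  -- (ii) value growth: `s ↦ φ s + η s − ½ m₀ s²` is monotone on `[0, ρ]`.
  have hval : ∀ t ∈ Icc 0 ρ, φ 0 - η * t + m₀ / 2 * t ^ 2 ≤ φ t := by
    intro t ht
    have hρ : (0 : ℝ) ≤ ρ := ht.1.trans ht.2
    have hder : ∀ s ∈ Icc 0 ρ,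
        HasDerivAt (fun s => φ s + s * η - s * s * (m₀ / 2)) (φ' s + η - s * m₀) s := by
      intro s hs
      have h1 := hd1 s hs
      have h2 : HasDerivAt (fun s : ℝ => s * η) (1 * η) s := (hasDerivAt_id' s).mul_const η
      have h3 : HasDerivAt (fun s : ℝ => s * s * (m₀ / 2)) ((1 * s + s * 1) * (m₀ / 2)) s :=
        ((hasDerivAt_id' s).mul (hasDerivAt_id' s)).mul_const (m₀ / 2)
      exact ((h1.add h2).sub h3).congr_deriv (by ring)
    have hmono : MonotoneOn (fun s => φ s + s * η - s * s * (m₀ / 2)) (Icc 0 ρ) :=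
      monotoneOn_of_hasDerivWithinAt_nonneg (convex_Icc 0 ρ)
        (fun s hs => (hder s hs).continuousAt.continuousWithinAt)
        (fun s hs => (hder s (interior_subset hs)).hasDerivWithinAt)
        (fun s hs => by have := hslope s (interior_subset hs); linarith)
    have := hmono (left_mem_Icc.2 hρ) ht ht.1
    simp only [zero_mul, add_zero, sub_zero, mul_zero] at this
    have hsq : t ^ 2 = t * t := sq t
    linarith
  refine ⟨hslope, fun t ht => ?_⟩
  have h := hval t ⟨hr₁.trans ht.1, ht.2⟩
  have hq' := hq t ht
  linarith

/-- The numeric side condition of `inner_bound` propagates from `t = r₁` to all `t ≥ r₁`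
(for `m₀, δ₀ ≥ 0`, `r₁ > 0`): the explicit core radius is any `r₁` with `δ₀ + η r₁ ≤ ½ m₀ r₁²`,
e.g. `r₁ = (η + √(η² + 2 m₀ δ₀)) / m₀`. -/
theorem quad_tail {m₀ η δ₀ r₁ : ℝ} (hm₀ : 0 ≤ m₀) (hδ₀ : 0 ≤ δ₀) (hr₁ : 0 < r₁)
    (h : δ₀ + η * r₁ ≤ m₀ / 2 * r₁ ^ 2) : ∀ t, r₁ ≤ t → δ₀ + η * t ≤ m₀ / 2 * t ^ 2 := by
  intro t ht
  have hη : η * r₁ ≤ m₀ / 2 * r₁ * r₁ := by nlinarith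
  have hη' : η ≤ m₀ / 2 * r₁ := le_of_mul_le_mul_right hη hr₁
  have h1 : 0 ≤ t - r₁ := sub_nonneg.2 ht
  nlinarith [mul_nonneg h1 hm₀, mul_nonneg h1 hr₁.le, mul_le_mul_of_nonneg_left ht (mul_nonneg (by norm_num : (0:ℝ) ≤ 1/2) hm₀), mul_nonneg (mul_nonneg hm₀ hr₁.le) h1]

/-- THE RAY BOUND.  Strong radial convexity on `[0, ρ]`, the disjunction (no radially-critical
non-convex point) on `[ρ, T]`, and the centre data give `φ ≥ b` on `[r₁, T]`. -/
theorem ray_bound {φ φ' φ'' : ℝ → ℝ} {T ρ m₀ η δ₀ b r₁ : ℝ}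
    (hr₁ : 0 ≤ r₁) (hrρ : r₁ ≤ ρ) (hρT : ρ ≤ T)
    (hd1 : ∀ t ∈ Icc 0 T, HasDerivAt φ (φ' t) t) (hd2 : ∀ t ∈ Icc 0 T, HasDerivAt φ' (φ'' t) t)
    (hconv : ∀ t ∈ Icc 0 ρ, m₀ ≤ φ'' t) (hdisj : ∀ t ∈ Icc ρ T, 0 < φ' t ∨ 0 < φ'' t)
    (hη : -η ≤ φ' 0) (h0 : b - δ₀ ≤ φ 0)
    (hq : ∀ t ∈ Icc r₁ ρ, δ₀ + η * t ≤ m₀ / 2 * t ^ 2) (hρη : η < m₀ * ρ) :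
    ∀ t ∈ Icc r₁ T, b ≤ φ t := by
  have hρ0 : 0 ≤ ρ := hr₁.trans hrρ
  have hsubρ : Icc 0 ρ ⊆ Icc 0 T := Icc_subset_Icc_right hρT
  obtain ⟨hslope, hval⟩ :=
    inner_bound (fun t ht => hd1 t (hsubρ ht)) (fun t ht => hd2 t (hsubρ ht)) hconv hη h0 hq hr₁
  have hφ'ρ : 0 < φ' ρ := by
    have := hslope ρ (right_mem_Icc.2 hρ0)
    linarith
  have hsubT : Icc ρ T ⊆ Icc 0 T := Icc_subset_Icc_left hρ0
  have hpos : ∀ t ∈ Icc ρ T, 0 < φ' t := by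
    intro t ht
    rcases eq_or_lt_of_le ht.1 with h | h
    · rw [← h]; exact hφ'ρ
    · exact deriv_pos_of_disj (fun s hs => hd2 s (hsubT hs)) hdisj hφ'ρ.le t ⟨h, ht.2⟩
  have hmono : MonotoneOn φ (Icc ρ T) :=
    monotoneOn_of_hasDerivWithinAt_nonneg (convex_Icc ρ T)
      (fun s hs => (hd1 s (hsubT hs)).continuousAt.continuousWithinAt)
      (fun s hs => (hd1 s (hsubT (interior_subset hs))).hasDerivWithinAt)
      (fun s hs => (hpos s (interior_subset hs)).le)
  intro t ht
  rcases le_total t ρ with h | h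
  · exact hval t ⟨ht.1, h⟩
  · have h1 := hval ρ ⟨hrρ, le_rfl⟩
    have h2 := hmono (left_mem_Icc.2 hρT) ⟨h, ht.2⟩ h
    linarith

/-- Textbook form of the extremal reduction (three-point lemma): a convex ray function that is below
`b` at the centre and at least `b` at radius `r` stays at least `b` beyond `r`. -/
theorem convex_three_point {φ : ℝ → ℝ} {T b r t : ℝ} (hφ : ConvexOn ℝ (Icc 0 T) φ)
    (h0 : φ 0 < b) (hr : b ≤ φ r) (hr0 : 0 < r) (hrt : r ≤ t) (htT : t ≤ T) : b ≤ φ t := by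
  by_contra hlt
  push Not at hlt
  have ht0 : 0 < t := hr0.trans_le hrt
  set l := r / t with hl
  have hl0 : 0 < l := div_pos hr0 ht0
  have hl1 : l ≤ 1 := (div_le_one ht0).2 hrt
  have ha : (0 : ℝ) ≤ 1 - l := by linarith
  have hab : (1 - l) + l = 1 := by ring
  have key := hφ.2 (left_mem_Icc.2 (ht0.le.trans htT)) ⟨ht0.le, htT⟩ ha hl0.le hab
  simp only [smul_eq_mul, mul_zero, zero_add] at key
  have hlt' : l * t = r := by rw [hl]; field_simp
  rw [hlt'] at key
  have h1 : (1 - l) * φ 0 ≤ (1 - l) * b := mul_le_mul_of_nonneg_left h0.le (by linarith)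
  have h2 : l * φ t < l * b := mul_lt_mul_of_pos_left hlt hl0
  linarith

/-! ## §2 Assembly over a star-convex chart region -/

section Assembly

variable {E : Type*} [NormedAddCommGroup E] [NormedSpace ℝ E]

/-- THE RADIAL REDUCTION.  `ψ : E → ℝ` with radial first/second derivative fields `ψ₁ ψ₂` (in the sense
of `hd1`, `hd2`) on a region `K` star-convex about `x₀`.  Hypotheses: (C) strong radial convexity
`ψ₂ ≥ m₀` in all unit directions on `K ∩ {‖y − x₀‖ ≤ ρ}`; (B) at every `y ∈ K` with `‖y − x₀‖ ≥ ρ` the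
radial slope or the radial curvature is positive; (G) centre data.  Conclusion: `ψ ≥ b` on
`K ∩ {‖x − x₀‖ ≥ r₁}`. -/
theorem radial_reduction {ψ : E → ℝ} {ψ₁ ψ₂ : E → E → ℝ} {K : Set E} {x₀ : E}
    {ρ m₀ η δ₀ b r₁ : ℝ} (hK : StarConvex ℝ x₀ K)
    (hd1 : ∀ y ∈ K, ∀ u : E, HasDerivAt (fun t : ℝ => ψ (y + t • u)) (ψ₁ y u) 0)
    (hd2 : ∀ y ∈ K, ∀ u : E, HasDerivAt (fun t : ℝ => ψ₁ (y + t • u) u) (ψ₂ y u) 0)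
    (hC : ∀ y ∈ K, ‖y - x₀‖ ≤ ρ → ∀ u : E, ‖u‖ = 1 → m₀ ≤ ψ₂ y u)
    (hB : ∀ y ∈ K, ρ ≤ ‖y - x₀‖ →
      0 < ψ₁ y (‖y - x₀‖⁻¹ • (y - x₀)) ∨ 0 < ψ₂ y (‖y - x₀‖⁻¹ • (y - x₀)))
    (hG : ∀ u : E, ‖u‖ = 1 → -η ≤ ψ₁ x₀ u) (h0 : b - δ₀ ≤ ψ x₀)
    (hr₁ : 0 < r₁) (hrρ : r₁ ≤ ρ)
    (hq : ∀ t ∈ Icc r₁ ρ, δ₀ + η * t ≤ m₀ / 2 * t ^ 2) (hρη : η < m₀ * ρ) :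
    ∀ x ∈ K, r₁ ≤ ‖x - x₀‖ → b ≤ ψ x := by
  intro x hx hxr
  set ℓ := ‖x - x₀‖ with hℓ
  have hℓ0 : 0 < ℓ := hr₁.trans_le hxr
  set u : E := ℓ⁻¹ • (x - x₀) with hu
  have hu1 : ‖u‖ = 1 := by
    rw [hu, norm_smul, norm_inv, norm_norm, ← hℓ, inv_mul_cancel₀ hℓ0.ne']
  -- the ray `t ↦ x₀ + t • u`, `t ∈ [0, ℓ]`, lies in `K` and ends at `x`
  have hray : ∀ t ∈ Icc 0 ℓ, x₀ + t • u ∈ K := by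
    intro t ht
    have hb : 0 ≤ t * ℓ⁻¹ := mul_nonneg ht.1 (inv_nonneg.2 hℓ0.le)
    have hb1 : t * ℓ⁻¹ ≤ 1 := by
      rw [← div_eq_mul_inv]; exact (div_le_one hℓ0).2 ht.2
    have hmem := hK hx (a := 1 - t * ℓ⁻¹) (b := t * ℓ⁻¹) (by linarith) hb (by ring)
    have hid : x₀ + t • u = (1 - t * ℓ⁻¹) • x₀ + (t * ℓ⁻¹) • x := by
      rw [hu, smul_smul]
      module
    rw [hid]; exact hmem
  have hend : x₀ + ℓ • u = x := by
    rw [hu, smul_smul, mul_inv_cancel₀ hℓ0.ne', one_smul]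
    abel
  have hnorm : ∀ t : ℝ, 0 ≤ t → ‖x₀ + t • u - x₀‖ = t := by
    intro t ht
    rw [add_sub_cancel_left, norm_smul, hu1, mul_one, Real.norm_eq_abs, abs_of_nonneg ht]
  have hdir : ∀ t : ℝ, 0 < t → ‖x₀ + t • u - x₀‖⁻¹ • (x₀ + t • u - x₀) = u := by
    intro t ht
    rw [hnorm t ht.le, add_sub_cancel_left, smul_smul, inv_mul_cancel₀ ht.ne', one_smul]
  -- the ray functions
  set φ : ℝ → ℝ := fun t => ψ (x₀ + t • u) with hφ
  set φ' : ℝ → ℝ := fun t => ψ₁ (x₀ + t • u) u with hφ'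
  set φ'' : ℝ → ℝ := fun t => ψ₂ (x₀ + t • u) u with hφ''
  have hshift : ∀ t s : ℝ, x₀ + t • u + (s - t) • u = x₀ + s • u := by
    intro t s; rw [sub_smul]; abel
  have hd1' : ∀ t ∈ Icc 0 ℓ, HasDerivAt φ (φ' t) t := by
    intro t ht
    have h := hd1 (x₀ + t • u) (hray t ht) u
    have h' := HasDerivAt.comp_sub_const (f := fun s : ℝ => ψ (x₀ + t • u + s • u)) t t
      (by rw [sub_self]; exact h)
    simp only [hshift] at h'
    exact h'
  have hd2' : ∀ t ∈ Icc 0 ℓ, HasDerivAt φ' (φ'' t) t := by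
    intro t ht
    have h := hd2 (x₀ + t • u) (hray t ht) u
    have h' := HasDerivAt.comp_sub_const (f := fun s : ℝ => ψ₁ (x₀ + t • u + s • u) u) t t
      (by rw [sub_self]; exact h)
    simp only [hshift] at h'
    exact h'
  have hη' : -η ≤ φ' 0 := by
    rw [hφ']; simp only [zero_smul, add_zero]; exact hG u hu1
  have h0' : b - δ₀ ≤ φ 0 := by
    rw [hφ]; simp only [zero_smul, add_zero]; exact h0
  have hgoal : b ≤ φ ℓ → b ≤ ψ x := by
    intro h; rw [hφ] at h; simpa only [hend] using h
  apply hgoal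
  rcases le_or_gt ℓ ρ with hℓρ | hρℓ
  · -- the whole ray lies in the strong-convexity ball
    have hconv : ∀ t ∈ Icc 0 ℓ, m₀ ≤ φ'' t := fun t ht =>
      hC (x₀ + t • u) (hray t ht) (by rw [hnorm t ht.1]; exact ht.2.trans hℓρ) u hu1
    have hq' : ∀ t ∈ Icc r₁ ℓ, δ₀ + η * t ≤ m₀ / 2 * t ^ 2 := fun t ht =>
      hq t ⟨ht.1, ht.2.trans hℓρ⟩
    exact (inner_bound hd1' hd2' hconv hη' h0' hq' hr₁.le).2 ℓ ⟨hxr, le_rfl⟩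
  · -- inner ball by (C), outer part of the ray by the disjunction (B)
    have hρ0 : 0 < ρ := hr₁.trans_le hrρ
    have hconv : ∀ t ∈ Icc 0 ρ, m₀ ≤ φ'' t := fun t ht =>
      hC (x₀ + t • u) (hray t ⟨ht.1, ht.2.trans hρℓ.le⟩) (by rw [hnorm t ht.1]; exact ht.2) u hu1
    have hdisj : ∀ t ∈ Icc ρ ℓ, 0 < φ' t ∨ 0 < φ'' t := by
      intro t ht
      have ht0 : 0 < t := hρ0.trans_le ht.1
      have h := hB (x₀ + t • u) (hray t ⟨ht0.le, ht.2⟩) (by rw [hnorm t ht0.le]; exact ht.1)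
      rw [hdir t ht0] at h
      exact h
    exact ray_bound hr₁.le hrρ hρℓ.le hd1' hd2' hconv hdisj hη' h0' hq hρη ℓ ⟨hxr, le_rfl⟩

/-! ## §3 The same with an outer collar certified by value rows -/

/-- RADIAL REDUCTION WITH COLLAR.  As `radial_reduction`, but the disjunction (B) is only required on the
shell `ρ ≤ ‖y − x₀‖ ≤ ρ₁`, and beyond `ρ₁` the value inequality itself (V) is supplied (e.g. by the
existing Taylor value rows, whose cells are large there).  Rays from `x₀` leave the ball `‖· − x₀‖ ≤ ρ₁`
once and never return, so the two certificate families compose. -/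
theorem radial_reduction_collar {ψ : E → ℝ} {ψ₁ ψ₂ : E → E → ℝ} {K : Set E} {x₀ : E}
    {ρ ρ₁ m₀ η δ₀ b r₁ : ℝ} (hK : StarConvex ℝ x₀ K)
    (hd1 : ∀ y ∈ K, ∀ u : E, HasDerivAt (fun t : ℝ => ψ (y + t • u)) (ψ₁ y u) 0)
    (hd2 : ∀ y ∈ K, ∀ u : E, HasDerivAt (fun t : ℝ => ψ₁ (y + t • u) u) (ψ₂ y u) 0)
    (hC : ∀ y ∈ K, ‖y - x₀‖ ≤ ρ → ∀ u : E, ‖u‖ = 1 → m₀ ≤ ψ₂ y u)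
    (hB : ∀ y ∈ K, ρ ≤ ‖y - x₀‖ → ‖y - x₀‖ ≤ ρ₁ →
      0 < ψ₁ y (‖y - x₀‖⁻¹ • (y - x₀)) ∨ 0 < ψ₂ y (‖y - x₀‖⁻¹ • (y - x₀)))
    (hV : ∀ y ∈ K, ρ₁ ≤ ‖y - x₀‖ → b ≤ ψ y)
    (hG : ∀ u : E, ‖u‖ = 1 → -η ≤ ψ₁ x₀ u) (h0 : b - δ₀ ≤ ψ x₀)
    (hr₁ : 0 < r₁) (hrρ : r₁ ≤ ρ) (hρ₁ : 0 ≤ ρ₁)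
    (hq : ∀ t ∈ Icc r₁ ρ, δ₀ + η * t ≤ m₀ / 2 * t ^ 2) (hρη : η < m₀ * ρ) :
    ∀ x ∈ K, r₁ ≤ ‖x - x₀‖ → b ≤ ψ x := by
  intro x hx hxr
  rcases le_or_gt ρ₁ ‖x - x₀‖ with h | h
  · exact hV x hx h
  · -- work in `K' = K ∩ closedBall x₀ ρ₁`, star-convex about `x₀`
    set K' := K ∩ Metric.closedBall x₀ ρ₁ with hK'
    have hK'star : StarConvex ℝ x₀ K' :=
      hK.inter ((convex_closedBall x₀ ρ₁).starConvex (Metric.mem_closedBall_self hρ₁))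
    have hball : ∀ y ∈ K', ‖y - x₀‖ ≤ ρ₁ := fun y hy => by
      have := hy.2; rwa [Metric.mem_closedBall, dist_eq_norm] at this
    have hxK' : x ∈ K' := ⟨hx, by rw [Metric.mem_closedBall, dist_eq_norm]; exact h.le⟩
    exact radial_reduction hK'star (fun y hy u => hd1 y hy.1 u) (fun y hy u => hd2 y hy.1 u)
      (fun y hy hyρ u hu => hC y hy.1 hyρ u hu) (fun y hy hyρ => hB y hy.1 hyρ (hball y hy))
      hG h0 hr₁ hrρ hq hρη x hxK' hxr

end Assembly

end Summit.AtomisticToContinuum.Crystallization.Theorems.OverbindingBudgetAffineRadialReduction
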